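import Summits.CriticalPhenomena.PercolationContinuityZ3.Theorems.PercNearOneGluingNoHeavyQuantTreeBuiltAD3Cells
import Summits.CriticalPhenomena.PercolationContinuityZ3.Theorems.PercNearOneGluingNoHeavyQuantSGCLightPairPairLaw
import HarnessLib

/-!
# QUANT lane R8, T-DEC, ROUTE 2: the FRÉCHET DECOMPOSITION of a product of two pairs — `{l₁,h₁;α} ∗ {l₂,h₂;β}` is the two-piece mixture
# of its COMONOTONE and COUNTERMONOTONE sum laws (≤ 3 atoms each, mean `T₁+T₂`) — and the cell `AD3FrechetCell` that closes the
# pair ⊗ pair kinds (H⊗H, H⊗L2, L2⊗L2) of `AD3ProdCell`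

builds on p205010 (kernel theorem, internal audit signed; external expert review pending)

Support file (`--supports stmt-CriticalPhenomena-4575`), QUANT lane, LEAD seat prim-quant-lead (gen 35), rung R8 of
`run/shared/lean/prim/quant/LADDER.md`; continues typer g31's `…QuantTreeBuiltAD3Cells` (`IsAD3Component`, `AD3ProdCell`,
`treeBuiltAD3_of_cells : AD3GateCell → AD3ProdCell → TreeBuiltAD3`, `farTreeRow_of_AD3Cells`).  Three plain definitions (the two
Fréchet laws and the Fréchet weight — explicit formulae, no new notion), one `@[conjecture]` cell, theorems with standard axioms, no sorries.

THE IDENTITY (Fréchet–Hoeffding, law level).  Two independent two-point variables `X_A ∈ {l₁, h₁}` (`P(h₁) = α`) and `X_B ∈ {l₂, h₂}`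
(`P(h₂) = β`): the set of couplings of the two marginals is the SEGMENT between the comonotone coupling (cells `LL, HH` and one
off-diagonal cell) and the countermonotone one (cells `LH, HL` and one diagonal cell); the independent coupling is the point of that
segment with weight `λ = 1 − min(α,β)` (if `α+β ≥ 1`) resp. `λ = max(α,β)` (if `α+β ≤ 1`) on the comonotone end.  At the level of the
SUM `X_A + X_B` this reads
  `{l₁,h₁;α} ∗ {l₂,h₂;β} = λ·frCo + (1−λ)·frCt`,
  `frCo = {l₁+l₂: 1−max(α,β), (l₁+h₂ or h₁+l₂): |β−α|, h₁+h₂: min(α,β)}`,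
  `frCt = {l₁+h₂: 1−α, h₁+l₂: 1−β, h₁+h₂: α+β−1}` (`α+β ≥ 1`)  resp.  `{l₁+l₂: 1−α−β, l₁+h₂: β, h₁+l₂: α}` (`α+β ≤ 1`),
both of mean `T₁ + T₂` and with AT MOST THREE atoms (`lconv_TP_TP_eq_frechet`).  Hence (`ad3Decomp_lconv_TP_TP_of_frechet`): if `frCo`
and `frCt` are AD3⁺-decomposable at `(y, q, T₁+T₂, M₁+M₂)` — e.g. because they are ADMISSIBLE three-atom laws (typer g31's
`ad3Decomp_of_admissibleTriple`, file `…AD3TripleSplit`) — then so is the product.  This replaces the transport / regime analysis of the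
4-atom parallelogram (lead g34 FOR-PROVERS-AD3PROD-HH: 'HD ∨ antitone light ∨ a triple sub-cell') by ONE two-piece template whose
pieces are always the same two laws; the 'triple sub-cell' of that memo is exactly `frCt` (e.g. `{0,3;4/5}∗{0,1;4/5}` at `x = 4/5`:
`frCo = {0,4;4/5}` heavy, `frCt = {1,3,4; 1/5,1/5,3/5}` the admissible non-HD triple the LP found).

THE CELL `AD3FrechetCell` (`@[conjecture]`): for two pairs `A = {l₁,h₁;α}`, `B = {l₂,h₂;β}` (`lᵢ < hᵢ ≤ Mᵢ`, `0 ≤ α, β ≤ 1`) that are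
ADMISSIBLE (`gate_q` DEC at every layer `j′ < Mᵢ`, floor `y`; heavy pairs are, `heavyPair_gate_decAt`) and top-affordable
(`y·Mᵢ ≤ q·Tᵢ`), at `0 < y < q ≤ 1`: `gate_q frCo` and `gate_q frCt` are DEC at every layer `j′ < M₁+M₂`.  EXACT CENSUS (lead g35,
`quant/prim-quant-lead-g35/explore/frechet.py`, `fc_census.py`; exact rational flow LPs; both pairs heavy / light-admissible incl.
the pair PIECES of admissible triples when admissible, gates at the heavy threshold, TA-tight tops, `α = β`, `α + β = 1`, `q` from `1`
to `1/5`): 13 536 pair⊗pair sub-products of sampled AD3⁺ components with both pieces good — 0 failures of either law; the direct census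
of the cell is recorded in the lane INBOX / README V-row of this generation.  The ONLY failures seen involve an INADMISSIBLE light piece
of a triple (then the product itself can be inadmissible) — outside the cell.

CONSEQUENCE (this file, kernel): `ad3Decomp_lconv_TP_TP_of_frechet` + the cell + the admissible-triple lemma give the H⊗H, H⊗L2 and
L2⊗L2 kinds of `AD3ProdCell`; the assembly `AD3FrechetCell → (pair kinds of AD3ProdCell)` is the next file (it needs `…AD3TripleSplit`).
The kinds with a TRIPLE component (H⊗L3, L2⊗L3, L3⊗L3) are NOT covered: splitting the triple into its two mean-`T` pair pieces and
applying the template to each piece works iff both pieces are admissible (76–100 % of sampled instances by kind); the residue (an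
inadmissible light piece) needs a second template — OPEN, see the lead g35 memo.
HONEST STATUS: `AD3FrechetCell`, `AD3ProdCell`, `AD3GateCell`, `TreeBuiltAD3`, `FarTreeRow` OPEN; nothing here is a published result;
RATE class log\* / honest sentence unchanged.

PRIOR ART.  The Fréchet–Hoeffding bounds / extremal couplings of two marginals are classical [folklore] (Hoeffding 1940, Fréchet 1951;
comonotonicity in risk theory); that the 2×2 coupling polytope is a segment containing the independent coupling is an elementary
instance.  Their use as an AD3⁺ decomposition template for the lane's DEC cones is [this work].  The gluing rows served
[cite: KozmaNitzan2024, Conjecture 3 (p. 15)]; product measure [cite: Grimmett1999, §1.3 p. 10].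
-/

noncomputable section

namespace Summit.CriticalPhenomena.PercolationContinuityZ3.Theorems

namespace Quant

open Finset

/-- two-point law notation `TP[lo, hi, g, h] = g·[h = hi] + (1 − g)·[h = lo]` (as in the lane's other files). -/
local notation3 "TP[" lo ", " hi ", " g ", " h "]" =>
  (g : ℝ) * (if (h : ℕ) = (hi : ℕ) then (1 : ℝ) else 0) + (1 - (g : ℝ)) * (if (h : ℕ) = (lo : ℕ) then (1 : ℝ) else 0)

/-- three-atom law notation `TR[s₁, s₂, s₃, p₁, p₂, p₃, h] = p₁·[h = s₁] + p₂·[h = s₂] + p₃·[h = s₃]`. -/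
local notation3 "TR[" s₁ ", " s₂ ", " s₃ ", " p₁ ", " p₂ ", " p₃ ", " h "]" =>
  (p₁ : ℝ) * (if (h : ℕ) = (s₁ : ℕ) then (1 : ℝ) else 0) + (p₂ : ℝ) * (if (h : ℕ) = (s₂ : ℕ) then (1 : ℝ) else 0)
    + (p₃ : ℝ) * (if (h : ℕ) = (s₃ : ℕ) then (1 : ℝ) else 0)

namespace LawDec

/-! ### The two Fréchet laws and the Fréchet weight -/

/-- **COMONOTONE SUM LAW** of `{l₁,h₁;α}` and `{l₂,h₂;β}`: atoms `l₁+l₂` (mass `1 − max(α,β)`), the off-diagonal atom `l₁+h₂` if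
`α ≤ β` (mass `β − α`) else `h₁+l₂` (mass `α − β`), and `h₁+h₂` (mass `min(α,β)`); written with the lane's `TR` pattern. [this work] -/
def frCo (l₁ h₁ l₂ h₂ : ℕ) (α β : ℝ) : ℕ → ℝ := fun h =>
  if α ≤ β then TR[l₁ + l₂, l₁ + h₂, h₁ + h₂, 1 - β, β - α, α, h]
  else TR[l₁ + l₂, h₁ + l₂, h₁ + h₂, 1 - α, α - β, β, h]

/-- **COUNTERMONOTONE SUM LAW** of `{l₁,h₁;α}` and `{l₂,h₂;β}`: for `α + β ≥ 1` atoms `l₁+h₂` (`1−α`), `h₁+l₂` (`1−β`), `h₁+h₂`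
(`α+β−1`); for `α + β ≤ 1` atoms `l₁+l₂` (`1−α−β`), `l₁+h₂` (`β`), `h₁+l₂` (`α`). [this work] -/
def frCt (l₁ h₁ l₂ h₂ : ℕ) (α β : ℝ) : ℕ → ℝ := fun h =>
  if 1 ≤ α + β then TR[l₁ + h₂, h₁ + l₂, h₁ + h₂, 1 - α, 1 - β, α + β - 1, h]
  else TR[l₁ + l₂, l₁ + h₂, h₁ + l₂, 1 - α - β, β, α, h]

/-- **FRÉCHET WEIGHT**: the weight of the comonotone law in the independent coupling, `1 − min(α,β)` if `α+β ≥ 1`, else `max(α,β)`.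
[this work] -/
def frLam (α β : ℝ) : ℝ := if 1 ≤ α + β then 1 - min α β else max α β

/-- `0 ≤ frLam α β ≤ 1` for gates in `[0,1]`. [this work] -/
theorem frLam_mem (α β : ℝ) (hα0 : 0 ≤ α) (hα1 : α ≤ 1) (hβ0 : 0 ≤ β) (hβ1 : β ≤ 1) :
    0 ≤ frLam α β ∧ frLam α β ≤ 1 := by
  simp only [frLam, min_def, max_def]
  split_ifs <;> constructor <;> linarith

/-- **THE FRÉCHET IDENTITY**: `{l₁,h₁;α} ∗ {l₂,h₂;β} = frLam·frCo + (1 − frLam)·frCt` as laws on `ℕ` (`hᵢ ≤ Mᵢ` so that `lconv`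
sees all four atoms). [this work] -/
theorem lconv_TP_TP_eq_frechet (M₁ M₂ l₁ h₁ l₂ h₂ : ℕ) (α β : ℝ) (hl₁ : l₁ ≤ h₁) (hh₁ : h₁ ≤ M₁) (hl₂ : l₂ ≤ h₂)
    (hh₂ : h₂ ≤ M₂) :
    lconv M₁ M₂ (fun k => TP[l₁, h₁, α, k]) (fun k => TP[l₂, h₂, β, k]) =
      fun h => frLam α β * frCo l₁ h₁ l₂ h₂ α β h + (1 - frLam α β) * frCt l₁ h₁ l₂ h₂ α β h := by
  funext h
  have e := gate_lconv_TP_TP_apply 1 α β M₁ M₂ l₁ h₁ l₂ h₂ hl₁ hh₁ hl₂ hh₂ h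
  rw [gate_one] at e
  rw [e]
  simp only [frLam, frCo, frCt, min_def, max_def]
  split_ifs <;> ring

/-- law facts of `frCo`: nonnegative, vanishing above `h₁+h₂`, mass `1`, mean `T₁+T₂` (`Tᵢ = lᵢ + (hᵢ−lᵢ)γᵢ`), for gates in `[0,1]`
and `lᵢ ≤ hᵢ`, `h₁ + h₂ ≤ M`. [this work] -/
theorem frCo_laws (M l₁ h₁ l₂ h₂ : ℕ) (α β : ℝ) (hα0 : 0 ≤ α) (hα1 : α ≤ 1) (hβ0 : 0 ≤ β) (hβ1 : β ≤ 1)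
    (hl₁ : l₁ ≤ h₁) (hl₂ : l₂ ≤ h₂) (hM : h₁ + h₂ ≤ M) :
    (∀ k, 0 ≤ frCo l₁ h₁ l₂ h₂ α β k) ∧ (∀ k, M < k → frCo l₁ h₁ l₂ h₂ α β k = 0) ∧
    (∑ k ∈ Finset.range (M + 1), frCo l₁ h₁ l₂ h₂ α β k = 1) ∧
    (∑ k ∈ Finset.range (M + 1), (k : ℝ) * frCo l₁ h₁ l₂ h₂ α β k
      = ((l₁ : ℝ) + ((h₁ : ℝ) - l₁) * α) + ((l₂ : ℝ) + ((h₂ : ℝ) - l₂) * β)) := by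
  by_cases hab : α ≤ β
  · obtain ⟨a, b, c, d⟩ := triple_laws' (1 - β) (β - α) α (((l₁ : ℝ) + ((h₁ : ℝ) - l₁) * α) + ((l₂ : ℝ) + ((h₂ : ℝ) - l₂) * β))
      M (l₁ + l₂) (l₁ + h₂) (h₁ + h₂) (by omega) (by omega) hM (by linarith) (by linarith) hα0 (by ring) (by push_cast; ring)
    have ef : frCo l₁ h₁ l₂ h₂ α β = fun h => TR[l₁ + l₂, l₁ + h₂, h₁ + h₂, 1 - β, β - α, α, h] := by
      funext h; simp only [frCo, if_pos hab]
    rw [ef]; exact ⟨a, b, c, d⟩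
  · rw [not_le] at hab
    obtain ⟨a, b, c, d⟩ := triple_laws' (1 - α) (α - β) β (((l₁ : ℝ) + ((h₁ : ℝ) - l₁) * α) + ((l₂ : ℝ) + ((h₂ : ℝ) - l₂) * β))
      M (l₁ + l₂) (h₁ + l₂) (h₁ + h₂) (by omega) (by omega) hM (by linarith) (by linarith) hβ0 (by ring) (by push_cast; ring)
    have ef : frCo l₁ h₁ l₂ h₂ α β = fun h => TR[l₁ + l₂, h₁ + l₂, h₁ + h₂, 1 - α, α - β, β, h] := by
      funext h; simp only [frCo, if_neg (not_le.2 hab)]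
    rw [ef]; exact ⟨a, b, c, d⟩

/-- law facts of `frCt` (same data). [this work] -/
theorem frCt_laws (M l₁ h₁ l₂ h₂ : ℕ) (α β : ℝ) (hα0 : 0 ≤ α) (hα1 : α ≤ 1) (hβ0 : 0 ≤ β) (hβ1 : β ≤ 1)
    (hl₁ : l₁ ≤ h₁) (hl₂ : l₂ ≤ h₂) (hM : h₁ + h₂ ≤ M) :
    (∀ k, 0 ≤ frCt l₁ h₁ l₂ h₂ α β k) ∧ (∀ k, M < k → frCt l₁ h₁ l₂ h₂ α β k = 0) ∧
    (∑ k ∈ Finset.range (M + 1), frCt l₁ h₁ l₂ h₂ α β k = 1) ∧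
    (∑ k ∈ Finset.range (M + 1), (k : ℝ) * frCt l₁ h₁ l₂ h₂ α β k
      = ((l₁ : ℝ) + ((h₁ : ℝ) - l₁) * α) + ((l₂ : ℝ) + ((h₂ : ℝ) - l₂) * β)) := by
  by_cases hab : 1 ≤ α + β
  · obtain ⟨a, b, c, d⟩ := triple_laws' (1 - α) (1 - β) (α + β - 1)
      (((l₁ : ℝ) + ((h₁ : ℝ) - l₁) * α) + ((l₂ : ℝ) + ((h₂ : ℝ) - l₂) * β))
      M (l₁ + h₂) (h₁ + l₂) (h₁ + h₂) (by omega) (by omega) hM (by linarith) (by linarith) (by linarith) (by ring)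
      (by push_cast; ring)
    have ef : frCt l₁ h₁ l₂ h₂ α β = fun h => TR[l₁ + h₂, h₁ + l₂, h₁ + h₂, 1 - α, 1 - β, α + β - 1, h] := by
      funext h; simp only [frCt, if_pos hab]
    rw [ef]; exact ⟨a, b, c, d⟩
  · rw [not_le] at hab
    obtain ⟨a, b, c, d⟩ := triple_laws' (1 - α - β) β α
      (((l₁ : ℝ) + ((h₁ : ℝ) - l₁) * α) + ((l₂ : ℝ) + ((h₂ : ℝ) - l₂) * β))
      M (l₁ + l₂) (l₁ + h₂) (h₁ + l₂) (by omega) (by omega) (by omega) (by linarith) hβ0 hα0 (by ring) (by push_cast; ring)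
    have ef : frCt l₁ h₁ l₂ h₂ α β = fun h => TR[l₁ + l₂, l₁ + h₂, h₁ + l₂, 1 - α - β, β, α, h] := by
      funext h; simp only [frCt, if_neg (not_le.2 hab)]
    rw [ef]; exact ⟨a, b, c, d⟩

/-! ### The product is AD3⁺ as soon as its two Fréchet laws are -/

/-- **FRÉCHET TEMPLATE**: if the comonotone and the countermonotone sum laws of `{l₁,h₁;α}`, `{l₂,h₂;β}` are AD3⁺-decomposable at
`(y, q, T, M₁+M₂)`, so is the product `{l₁,h₁;α} ∗ {l₂,h₂;β}` (mixture with the Fréchet weight; `ad3Decomp_mixture`). [this work] -/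
theorem ad3Decomp_lconv_TP_TP_of_frechet (y q T α β : ℝ) (M₁ M₂ l₁ h₁ l₂ h₂ : ℕ) (hl₁ : l₁ ≤ h₁) (hh₁ : h₁ ≤ M₁)
    (hl₂ : l₂ ≤ h₂) (hh₂ : h₂ ≤ M₂) (hα0 : 0 ≤ α) (hα1 : α ≤ 1) (hβ0 : 0 ≤ β) (hβ1 : β ≤ 1)
    (hco : AD3Decomp y q T (M₁ + M₂) (frCo l₁ h₁ l₂ h₂ α β))
    (hct : AD3Decomp y q T (M₁ + M₂) (frCt l₁ h₁ l₂ h₂ α β)) :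
    AD3Decomp y q T (M₁ + M₂) (lconv M₁ M₂ (fun k => TP[l₁, h₁, α, k]) (fun k => TP[l₂, h₂, β, k])) := by
  obtain ⟨hlam0, hlam1⟩ := frLam_mem α β hα0 hα1 hβ0 hβ1
  rw [lconv_TP_TP_eq_frechet M₁ M₂ l₁ h₁ l₂ h₂ α β hl₁ hh₁ hl₂ hh₂]
  refine ad3Decomp_mixture y q T (M₁ + M₂) _ (fun b : Bool => cond b (frLam α β) (1 - frLam α β))
    (fun b => cond b (frCo l₁ h₁ l₂ h₂ α β) (frCt l₁ h₁ l₂ h₂ α β)) (fun b => ?_) ?_ (fun h => ?_) (fun b _ => ?_)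
  · cases b <;> simp only [cond_true, cond_false] <;> linarith
  · rw [Fintype.sum_bool]; simp only [cond_true, cond_false]; ring
  · rw [Fintype.sum_bool]; simp only [cond_true, cond_false]
  · cases b
    · simpa only [cond_false] using hct
    · simpa only [cond_true] using hco

/-! ### The cell -/

/-- **CELL `AD3FrechetCell` (lead g35): the two Fréchet laws of two admissible top-affordable pairs are admissible.**  Floor and gate
`0 < y < q ≤ 1`; pairs `{l₁,h₁;α}`, `{l₂,h₂;β}` with `lᵢ < hᵢ ≤ Mᵢ`, `0 ≤ α, β ≤ 1`, top-affordable (`y·Mᵢ ≤ q·Tᵢ`,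
`Tᵢ` the pair means) and ADMISSIBLE (`gate_q {lᵢ,hᵢ;γᵢ}` DEC at every layer `j′ < Mᵢ` at floor `y` — automatic for heavy pairs,
`heavyPair_gate_decAt`; the datum of an L2 component).  CONCLUSION: `gate_q frCo` and `gate_q frCt` are DEC at every layer `j′ < M₁+M₂`.
With `ad3Decomp_lconv_TP_TP_of_frechet` and typer g31's `ad3Decomp_of_admissibleTriple` this gives the pair ⊗ pair kinds of
`AD3ProdCell`.  EVIDENCE: exact census 0 / 13 536 (module docstring) plus the direct census of this generation.
builds on p205010 (kernel theorem, internal audit signed; external expert review pending). [this work] [status: open] -/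
@[conjecture] def AD3FrechetCell : Prop :=
  ∀ (y q α β : ℝ) (M₁ M₂ l₁ h₁ l₂ h₂ : ℕ),
    0 < y → y < q → q ≤ 1 → l₁ < h₁ → h₁ ≤ M₁ → l₂ < h₂ → h₂ ≤ M₂ → 0 ≤ α → α ≤ 1 → 0 ≤ β → β ≤ 1 →
    y * (M₁ : ℝ) ≤ q * ((l₁ : ℝ) + ((h₁ : ℝ) - l₁) * α) → y * (M₂ : ℝ) ≤ q * ((l₂ : ℝ) + ((h₂ : ℝ) - l₂) * β) →
    (∀ j', j' < M₁ → DECAt y j' M₁ (gate (fun h => TP[l₁, h₁, α, h]) q)) →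
    (∀ j', j' < M₂ → DECAt y j' M₂ (gate (fun h => TP[l₂, h₂, β, h]) q)) →
    (∀ j', j' < M₁ + M₂ → DECAt y j' (M₁ + M₂) (gate (frCo l₁ h₁ l₂ h₂ α β) q)) ∧
    (∀ j', j' < M₁ + M₂ → DECAt y j' (M₁ + M₂) (gate (frCt l₁ h₁ l₂ h₂ α β) q))

end LawDec

end Quant

end Summit.CriticalPhenomena.PercolationContinuityZ3.Theorems
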